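import Mathlib
import HarnessLib

/-!
# Route `KLProgramme` — crux C4a, S3 brick (B4): the CAUSTIC TRANSPORT IDENTITY — differentiating a window integral `∫ w(θ,ϑ)•g(d(θ,ϑ)) dϑ` in the
# base angle WITHOUT differentiating the cusp profile `g`, when the level function `d` is transported (`∂_θ d = q·∂_ϑ d` on the support of `w`)

Cell `gate-hubbard-kl`, seat hubbard-kl-k3c3-p3 (g39; row «implicit-function / monotonicity route for μ(n)»).  Located brick for the (C)-closer lane / the `M_k` assembly
(stub (C) `stub_twoLeg_curvature` of `KLRegimeEngineV17F2`, stmt-HubbardSuperconductivity-20437), memo HOME/hubbard-kl-k3c3-p3/K2-FIRST-STEP.md §4 (γ) / §5(c).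

WHY.  K2-FIRST-STEP located «ABS-INSIDE-HIGH-ORDERS»: along the co-moving orbit the above-scale bubbles cross the UMKLAPP caustics transversally and carry one-sided
√-cusps `A·d₊^{1/2}` there; with `|·|` INSIDE the loop integral (`CoMovingJetsL1Theta`) the order-`k` dominators scale like `Λ^{3/2−k}` and exceed the k = 3, 4 ceilings at
the first scales near the window top, while the SIGNED jets are two to four orders smaller — because in `∫ w(θ,ϑ)·g(d(θ,ϑ)) dϑ` the cusp LOCUS `{d = 0}` moves smoothly
with `θ` and the `θ`-derivative can be transported onto the window weight.  This file types the one-variable-more twin of `…C4aLoopIBP` (where `∂/∂(level) = (1/g′)∂_φ`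
was transposed onto the weight): if `∂_θ d = q·∂_ϑ d` wherever `w(θ₀,·) ≠ 0` (near a transversal crossing `q = ∂_θd/∂_ϑd` is smooth), then for `g ∈ C¹`
        `d/dθ|_{θ₀} ∫_a^b w(θ,ϑ)•g(d(θ,ϑ)) dϑ = ∫_a^b [∂_θ w(θ₀,ϑ) − ∂_ϑ(q(θ₀,·)·w(θ₀,·))(ϑ)]•g(d(θ₀,ϑ)) dϑ`
— NO derivative lands on `g`; hence `‖d/dθ ∫ w•g(d)‖ ≤ sup|∂_θw − ∂_ϑ(qw)| · ∫_a^b ‖g(d(θ₀,ϑ))‖dϑ`, uniform in the sharpness of the cusp (the bubbles are smooth at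
every positive scale, so `g ∈ C¹` is no restriction; the point is the BOUND).  Iterating gives the transport operator `T_q w = ∂_θw − ∂_ϑ(qw)` to the power `k`
(successor file, with a reviewed `def`).
* §1 `hasDerivAt_curry_left/right` — partial derivatives of a jointly differentiable function as slices of the Fréchet derivative;
* §2 **`hasDerivAt_intervalIntegral_smul_comp_transport`** (HEADLINE, the identity) and **`norm_deriv_intervalIntegral_smul_comp_transport_le`** (the bound).
Carrier-free (`w q d : ℝ → ℝ → ℝ`, `g : ℝ → E`); Mathlib only; nothing is asserted about the Hubbard model, (C), K3 or superconductivity.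
References: FST II CPAM 51 (1998) §3 (regularity of the self-energy by integration by parts along the Fermi curve) [cite: FeldmanSalmhoferTrubowitz1998];
BGM 2006 §2.4 [cite: BenfattoGiulianiMastropietro2006]; Hörmander ALPDO I Thm 1.1.8 (differentiation under the integral).
-/

noncomputable section

namespace Summit.HubbardSuperconductivity.HubbardSuperconductivity.Theorems.C4a

set_option linter.dupNamespace false -- summit = problem name (single-conjunct summit), D-0017

open Real Set Filter MeasureTheory intervalIntegral Metric
open scoped Topology Interval

variable {E : Type*} [NormedAddCommGroup E] [NormedSpace ℝ E] [CompleteSpace E]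

/-! ## §1 Partial derivatives as slices of the Fréchet derivative -/

/-- `t ↦ Φ(t, ϑ)` has derivative `DΦ(θ,ϑ)(1,0)` at `θ`. [folklore] -/
theorem hasDerivAt_curry_left {F : Type*} [NormedAddCommGroup F] [NormedSpace ℝ F] {Φ : ℝ × ℝ → F} {θ ϑ : ℝ}
    (hΦ : DifferentiableAt ℝ Φ (θ, ϑ)) : HasDerivAt (fun t : ℝ => Φ (t, ϑ)) (fderiv ℝ Φ (θ, ϑ) ((1 : ℝ), (0 : ℝ))) θ := by
  have hinner : HasDerivAt (fun t : ℝ => ((t, ϑ) : ℝ × ℝ)) ((1 : ℝ), (0 : ℝ)) θ := (hasDerivAt_id θ).prodMk (hasDerivAt_const θ ϑ)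
  exact hΦ.hasFDerivAt.comp_hasDerivAt θ hinner

/-- `s ↦ Φ(θ, s)` has derivative `DΦ(θ,ϑ)(0,1)` at `ϑ`. [folklore] -/
theorem hasDerivAt_curry_right {F : Type*} [NormedAddCommGroup F] [NormedSpace ℝ F] {Φ : ℝ × ℝ → F} {θ ϑ : ℝ}
    (hΦ : DifferentiableAt ℝ Φ (θ, ϑ)) : HasDerivAt (fun s : ℝ => Φ (θ, s)) (fderiv ℝ Φ (θ, ϑ) ((0 : ℝ), (1 : ℝ))) ϑ := by
  have hinner : HasDerivAt (fun s : ℝ => ((θ, s) : ℝ × ℝ)) ((0 : ℝ), (1 : ℝ)) ϑ := (hasDerivAt_const ϑ θ).prodMk (hasDerivAt_id ϑ)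
  exact hΦ.hasFDerivAt.comp_hasDerivAt ϑ hinner

/-! ## §2 The transport identity -/

section Transport

variable {w q d : ℝ → ℝ → ℝ} {a b θ₀ : ℝ}

/-- A weight supported in `(a,b)` vanishes at the endpoints and outside. [folklore] -/
theorem apply_eq_zero_of_tsupport_subset_Ioo {f : ℝ → ℝ} (hsupp : tsupport f ⊆ Ioo a b) {x : ℝ} (hx : x ∉ Ioo a b) : f x = 0 :=
  image_eq_zero_of_notMem_tsupport fun h => hx (hsupp h)

/-- **THE CAUSTIC TRANSPORT IDENTITY** (HEADLINE).  `w, d` jointly `C¹` on `ℝ²`, `q(θ₀,·) ∈ C¹`, `g ∈ C¹`, `a ≤ b`, `tsupport w(θ₀,·) ⊆ (a,b)`, and the TRANSPORT RELATION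
`∂_θ d(θ₀,ϑ) = q(θ₀,ϑ)·∂_ϑ d(θ₀,ϑ)` wherever `w(θ₀,ϑ) ≠ 0` ⟹
`HasDerivAt (θ ↦ ∫_a^b w(θ,ϑ)•g(d(θ,ϑ)) dϑ) (∫_a^b [∂_θw(θ₀,ϑ) − (q(θ₀,·)·w(θ₀,·))′(ϑ)]•g(d(θ₀,ϑ)) dϑ) θ₀` — the derivative never touches `g`. [folklore] -/
theorem hasDerivAt_intervalIntegral_smul_comp_transport (hab : a ≤ b)
    (hw : ContDiff ℝ 1 fun p : ℝ × ℝ => w p.1 p.2) (hd : ContDiff ℝ 1 fun p : ℝ × ℝ => d p.1 p.2) (hq : ContDiff ℝ 1 (q θ₀))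
    (hsupp : tsupport (w θ₀) ⊆ Ioo a b)
    (hrel : ∀ ϑ ∈ Icc a b, w θ₀ ϑ ≠ 0 → deriv (fun t : ℝ => d t ϑ) θ₀ = q θ₀ ϑ * deriv (d θ₀) ϑ)
    {g : ℝ → E} (hg : ContDiff ℝ 1 g) :
    HasDerivAt (fun θ : ℝ => ∫ ϑ in a..b, w θ ϑ • g (d θ ϑ))
      (∫ ϑ in a..b, (deriv (fun t : ℝ => w t ϑ) θ₀ - deriv (fun s : ℝ => q θ₀ s * w θ₀ s) ϑ) • g (d θ₀ ϑ)) θ₀ := by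
  -- uncurried objects and the joint integrand
  set W : ℝ × ℝ → ℝ := fun p => w p.1 p.2 with hWdef
  set D : ℝ × ℝ → ℝ := fun p => d p.1 p.2 with hDdef
  set Φ : ℝ × ℝ → E := fun p => W p • g (D p) with hΦdef
  have hgD : ContDiff ℝ 1 fun p : ℝ × ℝ => g (D p) := hg.comp hd
  have hΦ : ContDiff ℝ 1 Φ := hw.smul hgD
  have hΦdiff : ∀ p, DifferentiableAt ℝ Φ p := fun p => (hΦ.differentiable one_ne_zero) p
  have hWdiff : ∀ p, DifferentiableAt ℝ W p := fun p => (hw.differentiable one_ne_zero) p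
  have hDdiff : ∀ p, DifferentiableAt ℝ D p := fun p => (hd.differentiable one_ne_zero) p
  have hgdiff : ∀ y, HasDerivAt g (deriv g y) y := fun y => ((hg.differentiable one_ne_zero) y).hasDerivAt
  -- the family and its θ-derivative
  set F : ℝ → ℝ → E := fun θ ϑ => Φ (θ, ϑ) with hFdef
  set F' : ℝ → ℝ → E := fun θ ϑ => fderiv ℝ Φ (θ, ϑ) ((1 : ℝ), (0 : ℝ)) with hF'def
  have hFfun : (fun θ : ℝ => ∫ ϑ in a..b, w θ ϑ • g (d θ ϑ)) = fun θ => ∫ ϑ in a..b, F θ ϑ := by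
    funext θ; simp only [hFdef, hΦdef, hWdef, hDdef]
  have h_diff : ∀ᵐ ϑ ∂volume, ϑ ∈ Ι a b → ∀ θ ∈ Ioo (θ₀ - 1) (θ₀ + 1), HasDerivAt (fun θ => F θ ϑ) (F' θ ϑ) θ :=
    Eventually.of_forall fun ϑ _ θ _ => hasDerivAt_curry_left (hΦdiff (θ, ϑ))
  -- continuity ⇒ measurability / integrability
  have hFc : ∀ θ, Continuous fun ϑ => F θ ϑ := fun θ => hΦ.continuous.comp (continuous_const.prodMk continuous_id)
  have hDΦc : Continuous fun p : ℝ × ℝ => fderiv ℝ Φ p := hΦ.continuous_fderiv one_ne_zero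
  have hF'c2 : Continuous fun p : ℝ × ℝ => F' p.1 p.2 := by
    simp only [hF'def]; exact hDΦc.clm_apply continuous_const
  have hF'c : ∀ θ, Continuous fun ϑ => F' θ ϑ := fun θ => hF'c2.comp (continuous_const.prodMk continuous_id)
  have hF_meas : ∀ᶠ θ in 𝓝 θ₀, AEStronglyMeasurable (fun ϑ => F θ ϑ) (volume.restrict (Ι a b)) :=
    Eventually.of_forall fun θ => (hFc θ).aestronglyMeasurable
  have hF_int : IntervalIntegrable (fun ϑ => F θ₀ ϑ) volume a b := (hFc θ₀).intervalIntegrable a b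
  have hF'_meas : AEStronglyMeasurable (fun ϑ => F' θ₀ ϑ) (volume.restrict (Ι a b)) := (hF'c θ₀).aestronglyMeasurable
  -- a uniform bound on the compact rectangle `[θ₀−1, θ₀+1] × [a, b]`
  have hK : IsCompact (Icc (θ₀ - 1) (θ₀ + 1) ×ˢ Icc a b) := isCompact_Icc.prod isCompact_Icc
  obtain ⟨C, hC⟩ := hK.exists_bound_of_continuousOn (hF'c2.norm.continuousOn)
  have h_bound : ∀ᵐ ϑ ∂volume, ϑ ∈ Ι a b → ∀ θ ∈ Ioo (θ₀ - 1) (θ₀ + 1), ‖F' θ ϑ‖ ≤ C := by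
    refine Eventually.of_forall fun ϑ hϑ θ hθ => ?_
    have hϑ' : ϑ ∈ Icc a b := by rw [uIoc_of_le hab] at hϑ; exact ⟨hϑ.1.le, hϑ.2⟩
    have h := hC (θ, ϑ) (mem_prod.2 ⟨⟨hθ.1.le, hθ.2.le⟩, hϑ'⟩)
    rw [norm_norm] at h
    exact h
  have hmain := (intervalIntegral.hasDerivAt_integral_of_dominated_loc_of_deriv_le (Ioo_mem_nhds (by linarith) (by linarith))
    hF_meas hF_int hF'_meas h_bound intervalIntegrable_const h_diff).2
  rw [hFfun]
  -- identify `∫ F' θ₀` with the transported integrand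
  have hval : (∫ ϑ in a..b, F' θ₀ ϑ) = ∫ ϑ in a..b, (deriv (fun t : ℝ => w t ϑ) θ₀ - deriv (fun s : ℝ => q θ₀ s * w θ₀ s) ϑ) • g (d θ₀ ϑ) := by
    -- the Fréchet slice: `F' θ₀ ϑ = ∂_θw • g(d) + w • (∂_θd • g′(d))`
    have hslice : ∀ ϑ, F' θ₀ ϑ = deriv (fun t : ℝ => w t ϑ) θ₀ • g (d θ₀ ϑ) + w θ₀ ϑ • (deriv (fun t : ℝ => d t ϑ) θ₀ • deriv g (d θ₀ ϑ)) := by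
      intro ϑ
      have h1 : HasDerivAt (fun t : ℝ => w t ϑ) (fderiv ℝ W (θ₀, ϑ) ((1 : ℝ), (0 : ℝ))) θ₀ := hasDerivAt_curry_left (hWdiff (θ₀, ϑ))
      have h2 : HasDerivAt (fun t : ℝ => d t ϑ) (fderiv ℝ D (θ₀, ϑ) ((1 : ℝ), (0 : ℝ))) θ₀ := hasDerivAt_curry_left (hDdiff (θ₀, ϑ))
      have h3 : HasDerivAt (fun t : ℝ => g (d t ϑ)) (fderiv ℝ D (θ₀, ϑ) ((1 : ℝ), (0 : ℝ)) • deriv g (d θ₀ ϑ)) θ₀ :=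
        (hgdiff (d θ₀ ϑ)).scomp θ₀ h2
      have h4 : HasDerivAt (fun t : ℝ => w t ϑ • g (d t ϑ))
          (w θ₀ ϑ • (fderiv ℝ D (θ₀, ϑ) ((1 : ℝ), (0 : ℝ)) • deriv g (d θ₀ ϑ)) + fderiv ℝ W (θ₀, ϑ) ((1 : ℝ), (0 : ℝ)) • g (d θ₀ ϑ)) θ₀ :=
        h1.smul h3
      have h5 : HasDerivAt (fun t : ℝ => w t ϑ • g (d t ϑ)) (F' θ₀ ϑ) θ₀ := hasDerivAt_curry_left (hΦdiff (θ₀, ϑ))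
      rw [h5.unique h4, h1.deriv, h2.deriv, add_comm]
    -- substitute the transport relation where `w ≠ 0` (both sides vanish where `w = 0`)
    have hsub : ∀ ϑ ∈ Icc a b, w θ₀ ϑ • (deriv (fun t : ℝ => d t ϑ) θ₀ • deriv g (d θ₀ ϑ)) =
        (q θ₀ ϑ * w θ₀ ϑ) • (deriv (d θ₀) ϑ • deriv g (d θ₀ ϑ)) := by
      intro ϑ hϑ
      by_cases h0 : w θ₀ ϑ = 0
      · rw [h0, mul_zero, zero_smul, zero_smul]
      · rw [hrel ϑ hϑ h0, smul_smul, smul_smul]; ring_nf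
    -- the loop integration by parts `∫ (q w) • (g∘d)′ = −∫ (q w)′ • g∘d` (no boundary terms)
    have hdθ : ContDiff ℝ 1 (d θ₀) := hd.comp (contDiff_const.prodMk contDiff_id)
    have hwθ : ContDiff ℝ 1 (w θ₀) := hw.comp (contDiff_const.prodMk contDiff_id)
    have hu : ContDiff ℝ 1 fun s : ℝ => q θ₀ s * w θ₀ s := hq.mul hwθ
    have hud : ∀ x, HasDerivAt (fun s : ℝ => q θ₀ s * w θ₀ s) (deriv (fun s : ℝ => q θ₀ s * w θ₀ s) x) x := fun x =>
      ((hu.differentiable one_ne_zero) x).hasDerivAt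
    have hdd : ∀ x, HasDerivAt (d θ₀) (deriv (d θ₀) x) x := fun x => ((hdθ.differentiable one_ne_zero) x).hasDerivAt
    have hvd : ∀ x, HasDerivAt (fun s : ℝ => g (d θ₀ s)) (deriv (d θ₀) x • deriv g (d θ₀ x)) x := fun x => (hgdiff (d θ₀ x)).scomp x (hdd x)
    have hu'c : Continuous (deriv fun s : ℝ => q θ₀ s * w θ₀ s) := hu.continuous_deriv le_rfl
    have hv'c : Continuous fun x => deriv (d θ₀) x • deriv g (d θ₀ x) :=
      (hdθ.continuous_deriv le_rfl).smul ((hg.continuous_deriv le_rfl).comp hdθ.continuous)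
    have hibp := intervalIntegral.integral_smul_deriv_eq_deriv_smul (u := fun s : ℝ => q θ₀ s * w θ₀ s) (v := fun s => g (d θ₀ s))
      (fun x _ => hud x) (fun x _ => hvd x) (hu'c.intervalIntegrable a b) (hv'c.intervalIntegrable a b)
    have ha0 : q θ₀ a * w θ₀ a = 0 := by rw [apply_eq_zero_of_tsupport_subset_Ioo hsupp fun h => (lt_irrefl a) h.1, mul_zero]
    have hb0 : q θ₀ b * w θ₀ b = 0 := by rw [apply_eq_zero_of_tsupport_subset_Ioo hsupp fun h => (lt_irrefl b) h.2, mul_zero]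
    rw [ha0, hb0, zero_smul, zero_smul, sub_zero, zero_sub] at hibp
    -- assemble
    have hIcont₁ : Continuous fun ϑ => deriv (fun t : ℝ => w t ϑ) θ₀ • g (d θ₀ ϑ) := by
      have hc : Continuous fun ϑ => fderiv ℝ W (θ₀, ϑ) ((1 : ℝ), (0 : ℝ)) :=
        ((hw.continuous_fderiv one_ne_zero).comp (continuous_const.prodMk continuous_id)).clm_apply continuous_const
      have he : ∀ ϑ, deriv (fun t : ℝ => w t ϑ) θ₀ = fderiv ℝ W (θ₀, ϑ) ((1 : ℝ), (0 : ℝ)) :=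
        fun ϑ => (hasDerivAt_curry_left (hWdiff (θ₀, ϑ))).deriv
      simp only [he]
      exact hc.smul (hg.continuous.comp hdθ.continuous)
    have hIcont₂ : Continuous fun ϑ => (q θ₀ ϑ * w θ₀ ϑ) • (deriv (d θ₀) ϑ • deriv g (d θ₀ ϑ)) := hu.continuous.smul hv'c
    have hIcont₃ : Continuous fun ϑ => deriv (fun s : ℝ => q θ₀ s * w θ₀ s) ϑ • g (d θ₀ ϑ) := hu'c.smul (hg.continuous.comp hdθ.continuous)
    calc (∫ ϑ in a..b, F' θ₀ ϑ)
        = ∫ ϑ in a..b, (deriv (fun t : ℝ => w t ϑ) θ₀ • g (d θ₀ ϑ) + (q θ₀ ϑ * w θ₀ ϑ) • (deriv (d θ₀) ϑ • deriv g (d θ₀ ϑ))) := by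
          refine intervalIntegral.integral_congr fun ϑ hϑ => ?_
          rw [uIcc_of_le hab] at hϑ
          simp only [hslice ϑ, hsub ϑ hϑ]
      _ = (∫ ϑ in a..b, deriv (fun t : ℝ => w t ϑ) θ₀ • g (d θ₀ ϑ)) + ∫ ϑ in a..b, (q θ₀ ϑ * w θ₀ ϑ) • (deriv (d θ₀) ϑ • deriv g (d θ₀ ϑ)) :=
          intervalIntegral.integral_add (hIcont₁.intervalIntegrable a b) (hIcont₂.intervalIntegrable a b)
      _ = (∫ ϑ in a..b, deriv (fun t : ℝ => w t ϑ) θ₀ • g (d θ₀ ϑ)) - ∫ ϑ in a..b, deriv (fun s : ℝ => q θ₀ s * w θ₀ s) ϑ • g (d θ₀ ϑ) := by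
          rw [hibp, sub_eq_add_neg]
      _ = ∫ ϑ in a..b, (deriv (fun t : ℝ => w t ϑ) θ₀ - deriv (fun s : ℝ => q θ₀ s * w θ₀ s) ϑ) • g (d θ₀ ϑ) := by
          rw [← intervalIntegral.integral_sub (hIcont₁.intervalIntegrable a b) (hIcont₃.intervalIntegrable a b)]
          refine intervalIntegral.integral_congr fun ϑ _ => ?_
          simp only [sub_smul]
  rw [hval] at hmain
  exact hmain

/-- **THE TRANSPORT BOUND**: under the hypotheses of the identity, a bound `T` on the transported weight `|∂_θw(θ₀,·) − (q w)(θ₀,·)′|` on `[a,b]` gives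
`‖d/dθ|_{θ₀} ∫_a^b w(θ,ϑ)•g(d(θ,ϑ)) dϑ‖ ≤ T · ∫_a^b ‖g(d(θ₀,ϑ))‖ dϑ` — the `L¹` norm of the profile along the window, never its derivative. [folklore] -/
theorem norm_deriv_intervalIntegral_smul_comp_transport_le (hab : a ≤ b)
    (hw : ContDiff ℝ 1 fun p : ℝ × ℝ => w p.1 p.2) (hd : ContDiff ℝ 1 fun p : ℝ × ℝ => d p.1 p.2) (hq : ContDiff ℝ 1 (q θ₀))
    (hsupp : tsupport (w θ₀) ⊆ Ioo a b)
    (hrel : ∀ ϑ ∈ Icc a b, w θ₀ ϑ ≠ 0 → deriv (fun t : ℝ => d t ϑ) θ₀ = q θ₀ ϑ * deriv (d θ₀) ϑ)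
    {g : ℝ → E} (hg : ContDiff ℝ 1 g) {T : ℝ}
    (hT : ∀ ϑ ∈ Icc a b, |deriv (fun t : ℝ => w t ϑ) θ₀ - deriv (fun s : ℝ => q θ₀ s * w θ₀ s) ϑ| ≤ T) :
    ‖deriv (fun θ : ℝ => ∫ ϑ in a..b, w θ ϑ • g (d θ ϑ)) θ₀‖ ≤ T * ∫ ϑ in a..b, ‖g (d θ₀ ϑ)‖ := by
  rw [(hasDerivAt_intervalIntegral_smul_comp_transport hab hw hd hq hsupp hrel hg).deriv]
  have hdθ : Continuous (d θ₀) := (hd.comp (contDiff_const.prodMk contDiff_id)).continuous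
  have hgc : Continuous fun ϑ => ‖g (d θ₀ ϑ)‖ := (hg.continuous.comp hdθ).norm
  have hT0 : 0 ≤ T := by
    rcases le_or_gt a b with h | h
    · exact (abs_nonneg _).trans (hT a ⟨le_rfl, h⟩)
    · exact absurd hab (not_le.2 h)
  calc ‖∫ ϑ in a..b, (deriv (fun t : ℝ => w t ϑ) θ₀ - deriv (fun s : ℝ => q θ₀ s * w θ₀ s) ϑ) • g (d θ₀ ϑ)‖
      ≤ ∫ ϑ in a..b, ‖(deriv (fun t : ℝ => w t ϑ) θ₀ - deriv (fun s : ℝ => q θ₀ s * w θ₀ s) ϑ) • g (d θ₀ ϑ)‖ :=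
        intervalIntegral.norm_integral_le_integral_norm hab
    _ ≤ ∫ ϑ in a..b, T * ‖g (d θ₀ ϑ)‖ := by
        refine intervalIntegral.integral_mono_on hab ?_ (hgc.const_mul T |>.intervalIntegrable a b) fun ϑ hϑ => ?_
        · refine (Continuous.norm ?_).intervalIntegrable a b
          have hwθ : ContDiff ℝ 1 (w θ₀) := hw.comp (contDiff_const.prodMk contDiff_id)
          have hu : ContDiff ℝ 1 fun s : ℝ => q θ₀ s * w θ₀ s := hq.mul hwθ
          have hc : Continuous fun ϑ => fderiv ℝ (fun p : ℝ × ℝ => w p.1 p.2) (θ₀, ϑ) ((1 : ℝ), (0 : ℝ)) :=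
            ((hw.continuous_fderiv one_ne_zero).comp (continuous_const.prodMk continuous_id)).clm_apply continuous_const
          have he : ∀ ϑ, deriv (fun t : ℝ => w t ϑ) θ₀ = fderiv ℝ (fun p : ℝ × ℝ => w p.1 p.2) (θ₀, ϑ) ((1 : ℝ), (0 : ℝ)) :=
            fun ϑ => (hasDerivAt_curry_left ((hw.differentiable one_ne_zero) (θ₀, ϑ))).deriv
          have h1 : Continuous fun ϑ => deriv (fun t : ℝ => w t ϑ) θ₀ := by simp only [he]; exact hc
          exact (h1.sub (hu.continuous_deriv le_rfl)).smul (hg.continuous.comp hdθ)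
        · rw [norm_smul, Real.norm_eq_abs]
          exact mul_le_mul_of_nonneg_right (hT ϑ hϑ) (norm_nonneg _)
    _ = T * ∫ ϑ in a..b, ‖g (d θ₀ ϑ)‖ := intervalIntegral.integral_const_mul T _

end Transport

end Summit.HubbardSuperconductivity.HubbardSuperconductivity.Theorems.C4a

end
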